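import Summits.Ventures.HSemireg.ObstructionLocusCrossingExtTools

/-!
# Venture HSemireg — (S5) OBSTRUCTION LOCUS away from secant type, XXXIII: the DOUBLE COKERNEL `Y(N)` of a pair of
# scalar matrices — flattening of nested quotients, naturality, finite products

HONEST FRAMING.  Part of the Lean side of the computation cell `pub-hsemireg` (track «S4-PUSH» (ii), seat
s4-prove-2).  GENERIC linear algebra over a commutative ring `A` (file XXXI's scalar matrices).  Nothing here
constructs a variety or a sheaf; nothing here says that HC / HC_CM / HC_AV holds; no Literature fact is declared or
used; no object is certified.
The functor `N ↦ Y(N) := N^{T₁ × T₂} ⧸ (range(c on the inner index)^{T₁} + range(c' on the outer index))` is how `Ext²`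
of the ideal of a two-block model with itself presents itself after file XXXI's cokernels (file XXXV).

* FLATTENING.  `flatRel U c = U^{T₁} + range c_P` and **`flattenEquiv : P^{T₁} ⧸ flatRel U c ≃ₗ[A]
  (P ⧸ U)^{T₁} ⧸ range c_{P⧸U}`** for a scalar matrix `c` acting on `X`-valued families, `X = P`, `P ⧸ U`;
* `relY c c' N` (= `flatRel (range c_N) c'`), **`relY_map_compLeft`** — naturality along a surjection (entrywise
  `compLeft₂` of file XXXI);
* `piSwap`, `relY_pi_map_piSwap`, **`quotRelYPiEquiv : Y(Π_t Q_t) ≃ₗ[A] Π_t Y(Q_t)`** (finite products).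
References (dictionary only): EXT-NOTE.md §6.B(c).
-/

open scoped BigOperators

universe u

namespace Summit.Ventures.HSemireg.ObstructionLocus

/-! ## Flattening a quotient of quotient-valued families (tool T3a for EXT-NOTE §6.B(c))

For a submodule `U ≤ P`, finite index types `T₁, T₂` and a scalar matrix `c : T₁ → T₂ → A` (acting on `X`-valued
families `X^{T₂} → X^{T₁}` for every module `X`), the quotient of `(P ⧸ U)^{T₁}` by the range of the matrix on
`(P ⧸ U)`-valued families is the quotient of `P^{T₁}` by `U^{T₁} + range (matrix on P-valued families)`. -/

section Flatten

variable {A : Type u} [CommRing A] {P : Type u} [AddCommGroup P] [Module A P] (U : Submodule A P)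
  {T₁ T₂ : Type} [Fintype T₂] (c : T₁ → T₂ → A)

/-- Scalar matrices commute with every linear map applied entrywise. -/
theorem scalarMatrix_comp_compLeft {P' : Type u} [AddCommGroup P'] [Module A P'] (f : P →ₗ[A] P') :
    scalarMatrix P' c ∘ₗ f.compLeft T₂ = f.compLeft T₁ ∘ₗ scalarMatrix P c := by
  apply LinearMap.ext
  intro v
  funext b
  simp [scalarMatrix_apply, map_sum]

/-- The submodule `U^{T₁} + range(c on P-valued families)` of `P^{T₁}`. -/
noncomputable def flatRel : Submodule A (T₁ → P) :=
  Submodule.pi Set.univ (fun _ : T₁ => U) ⊔ LinearMap.range (scalarMatrix P c)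

/-- The comparison map `P^{T₁} ⧸ (U^{T₁} + range c_P) → (P ⧸ U)^{T₁} ⧸ range c_{P⧸U}`. -/
noncomputable def flattenMap :
    ((T₁ → P) ⧸ flatRel U c) →ₗ[A] ((T₁ → P ⧸ U) ⧸ LinearMap.range (scalarMatrix (P ⧸ U) c)) :=
  (flatRel U c).liftQ ((LinearMap.range (scalarMatrix (P ⧸ U) c)).mkQ ∘ₗ U.mkQ.compLeft T₁) (by
    rw [flatRel, sup_le_iff]
    constructor
    · intro v hv
      rw [LinearMap.mem_ker, LinearMap.comp_apply, Submodule.mkQ_apply, Submodule.Quotient.mk_eq_zero]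
      have : U.mkQ.compLeft T₁ v = 0 := by
        funext i
        simpa using (Submodule.mem_pi.1 hv) i (Set.mem_univ i)
      rw [this]
      exact Submodule.zero_mem _
    · rintro _ ⟨w, rfl⟩
      rw [LinearMap.mem_ker, LinearMap.comp_apply, Submodule.mkQ_apply, Submodule.Quotient.mk_eq_zero,
        ← LinearMap.comp_apply, ← scalarMatrix_comp_compLeft]
      exact ⟨_, rfl⟩)

/-- The comparison map on representatives. -/
theorem flattenMap_mk (v : T₁ → P) :
    flattenMap U c (Submodule.Quotient.mk v) = Submodule.Quotient.mk (fun i => Submodule.Quotient.mk (v i)) := rfl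

/-- Entrywise lifting of `(P ⧸ U)`-valued families. -/
theorem compLeft_mkQ_surjective (T : Type) : Function.Surjective (U.mkQ.compLeft T) := by
  intro f
  refine ⟨fun i => (Submodule.Quotient.mk_surjective U (f i)).choose, ?_⟩
  funext i
  exact (Submodule.Quotient.mk_surjective U (f i)).choose_spec

/-- The comparison map is onto. -/
theorem flattenMap_surjective : Function.Surjective (flattenMap U c) := by
  intro q
  obtain ⟨f, rfl⟩ := Submodule.Quotient.mk_surjective _ q
  obtain ⟨v, rfl⟩ := compLeft_mkQ_surjective U T₁ f
  exact ⟨Submodule.Quotient.mk v, rfl⟩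

/-- The comparison map is injective. -/
theorem flattenMap_injective : Function.Injective (flattenMap U c) := by
  rw [← LinearMap.ker_eq_bot, Submodule.eq_bot_iff]
  intro q hq
  obtain ⟨v, rfl⟩ := Submodule.Quotient.mk_surjective _ q
  rw [LinearMap.mem_ker, flattenMap_mk, Submodule.Quotient.mk_eq_zero, LinearMap.mem_range] at hq
  obtain ⟨y, hy⟩ := hq
  obtain ⟨w, rfl⟩ := compLeft_mkQ_surjective U T₂ y
  rw [← LinearMap.comp_apply, scalarMatrix_comp_compLeft, LinearMap.comp_apply] at hy
  -- `hy : mkQ ∘ (c w) = mkQ ∘ v`, so `v - c w ∈ U^{T₁}`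
  rw [Submodule.Quotient.mk_eq_zero, flatRel]
  have hvw : v - scalarMatrix P c w ∈ Submodule.pi Set.univ (fun _ : T₁ => U) := by
    rw [Submodule.mem_pi]
    intro i _
    have := congr_fun hy i
    simp only [LinearMap.compLeft_apply, Function.comp_apply, Submodule.mkQ_apply] at this
    rw [Pi.sub_apply, ← Submodule.Quotient.eq]
    exact this.symm
  have : v = (v - scalarMatrix P c w) + scalarMatrix P c w := by abel
  rw [this]
  exact Submodule.add_mem_sup hvw ⟨w, rfl⟩

/-- **Flattening**: `P^{T₁} ⧸ (U^{T₁} + range c_P) ≃ₗ[A] (P ⧸ U)^{T₁} ⧸ range c_{P ⧸ U}`. -/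
noncomputable def flattenEquiv :
    ((T₁ → P) ⧸ flatRel U c) ≃ₗ[A] ((T₁ → P ⧸ U) ⧸ LinearMap.range (scalarMatrix (P ⧸ U) c)) :=
  LinearEquiv.ofBijective (flattenMap U c) ⟨flattenMap_injective U c, flattenMap_surjective U c⟩

/-- `flattenEquiv` on representatives. -/
theorem flattenEquiv_mk (v : T₁ → P) :
    flattenEquiv U c (Submodule.Quotient.mk v) = Submodule.Quotient.mk (fun i => Submodule.Quotient.mk (v i)) := rfl

end Flatten

variable {A : Type u} [CommRing A]

/-! ## The relations submodule of `Y` and its naturality -/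

section RelY

variable {T₁ T₂ T₃ : Type} [Fintype T₂] [Fintype T₃] (c : T₂ → T₃ → A) (c' : T₁ → T₂ → A)

/-- The relations of `Y(N)`: `(range c_N)^{T₁} + range c'_{N^{T₂}}` inside `N^{T₁ × T₂}`
(this is file XXXI's `flatRel (range c_N) c'`). -/
noncomputable abbrev relY (N : Type u) [AddCommGroup N] [Module A N] : Submodule A (T₁ → T₂ → N) :=
  flatRel (LinearMap.range (scalarMatrix N c)) c'

variable {N N' : Type u} [AddCommGroup N] [Module A N] [AddCommGroup N'] [Module A N']

/-- **Naturality of the relations**: for `θ` onto, `relY(N') = relY(N).map(θ entrywise)`. -/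
theorem relY_map_compLeft (θ : N →ₗ[A] N') (hθ : Function.Surjective θ) :
    (relY c c' N).map (compLeft₂ θ) = relY c c' N' := by
  simp only [relY, flatRel, Submodule.map_sup]
  congr 1
  · apply le_antisymm
    · rintro _ ⟨f, hf, rfl⟩
      simp only [SetLike.mem_coe, Submodule.mem_pi] at hf ⊢
      intro i _
      obtain ⟨g, hg⟩ := hf i (Set.mem_univ i)
      refine ⟨θ.compLeft T₃ g, ?_⟩
      rw [← LinearMap.comp_apply, scalarMatrix_comp_compLeft, LinearMap.comp_apply, hg]
      rfl
    · intro f hf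
      rw [Submodule.mem_pi] at hf
      choose g hg using fun i => hf i (Set.mem_univ i)
      have hsurj : Function.Surjective (θ.compLeft T₃) := fun v =>
        ⟨fun b => (hθ (v b)).choose, funext fun b => (hθ (v b)).choose_spec⟩
      choose g' hg' using fun i => hsurj (g i)
      refine ⟨fun i => scalarMatrix N c (g' i), ?_, ?_⟩
      · simp only [SetLike.mem_coe, Submodule.mem_pi]; intro i _; exact ⟨g' i, rfl⟩
      · funext i
        show θ.compLeft T₂ (scalarMatrix N c (g' i)) = f i
        rw [← LinearMap.comp_apply, ← scalarMatrix_comp_compLeft, LinearMap.comp_apply, hg', hg]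
  · apply le_antisymm
    · rintro _ ⟨_, ⟨k, rfl⟩, rfl⟩
      refine ⟨compLeft₂ θ k, ?_⟩
      rw [← LinearMap.comp_apply, ← LinearMap.comp_apply, scalarMatrix_comp_compLeft]
    · rintro _ ⟨k, rfl⟩
      have hsurj : Function.Surjective (compLeft₂ (T₁ := T₂) (T₂ := T₂) θ) := fun v =>
        ⟨fun i j => (hθ (v i j)).choose, funext fun i => funext fun j => (hθ (v i j)).choose_spec⟩
      obtain ⟨k', rfl⟩ := hsurj k
      refine ⟨scalarMatrix _ c' k', ⟨k', rfl⟩, ?_⟩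
      rw [← LinearMap.comp_apply, ← LinearMap.comp_apply, scalarMatrix_comp_compLeft]

end RelY

/-! ## Finite products -/

section Prod

variable {T₁ T₂ T₃ : Type} [Fintype T₂] [Fintype T₃] (c : T₂ → T₃ → A) (c' : T₁ → T₂ → A)
  {τ : Type} [Fintype τ] [DecidableEq τ] (Q : τ → Type u) [∀ t, AddCommGroup (Q t)] [∀ t, Module A (Q t)]

/-- `(Π_t Q_t)^{T₁ × T₂} ≃ Π_t Q_t^{T₁ × T₂}` (swap of indices). -/
def piSwap : (T₁ → T₂ → (t : τ) → Q t) ≃ₗ[A] ((t : τ) → T₁ → T₂ → Q t) where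
  toFun f t i j := f i j t
  invFun g i j t := g t i j
  map_add' _ _ := rfl
  map_smul' _ _ := rfl
  left_inv _ := rfl
  right_inv _ := rfl

omit [Fintype τ] [DecidableEq τ] in
/-- Scalar matrices on product-valued vectors act componentwise. -/
theorem scalarMatrix_pi_apply {U₁ U₂ : Type} [Fintype U₁] (d : U₂ → U₁ → A) (v : U₁ → (t : τ) → Q t)
    (b : U₂) (t : τ) : scalarMatrix ((t : τ) → Q t) d v b t = scalarMatrix (Q t) d (fun a => v a t) b := by
  simp [scalarMatrix_apply, Finset.sum_apply, Pi.smul_apply]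

omit [Fintype τ] [DecidableEq τ] in
/-- **The relations of `Y(Π_t Q_t)` are the product of the relations of the `Y(Q_t)`.** -/
theorem relY_pi_map_piSwap :
    (relY c c' ((t : τ) → Q t)).map
        ((piSwap (A := A) (T₁ := T₁) (T₂ := T₂) Q : (T₁ → T₂ → (t : τ) → Q t) ≃ₗ[A] _) :
          (T₁ → T₂ → (t : τ) → Q t) →ₗ[A] ((t : τ) → T₁ → T₂ → Q t)) =
      Submodule.pi Set.univ (fun t => relY c c' (Q t)) := by
  simp only [relY, flatRel]
  apply le_antisymm
  · rw [Submodule.map_le_iff_le_comap, sup_le_iff]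
    constructor
    · intro f hf
      rw [Submodule.mem_comap, Submodule.mem_pi]
      intro t _
      rw [Submodule.mem_pi] at hf
      refine Submodule.mem_sup_left ?_
      rw [Submodule.mem_pi]
      intro i _
      obtain ⟨g, hg⟩ := hf i (Set.mem_univ i)
      refine ⟨fun a => g a t, ?_⟩
      funext b
      have := congr_fun hg b
      show scalarMatrix (Q t) c (fun a => g a t) b = f i b t
      rw [← this, scalarMatrix_pi_apply]
    · rintro _ ⟨k, rfl⟩
      rw [Submodule.mem_comap, Submodule.mem_pi]
      intro t _
      refine Submodule.mem_sup_right ⟨fun i j => k i j t, ?_⟩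
      funext i j
      show scalarMatrix (T₂ → Q t) c' (fun i j => k i j t) i j = scalarMatrix (T₂ → (t : τ) → Q t) c' k i j t
      simp [scalarMatrix_apply, Finset.sum_apply, Pi.smul_apply]
  · intro g hg
    rw [Submodule.mem_pi] at hg
    have hg' : ∀ t, ∃ u ∈ Submodule.pi Set.univ (fun _ : T₁ => LinearMap.range (scalarMatrix (Q t) c)),
        ∃ v ∈ LinearMap.range (scalarMatrix (T₂ → Q t) c'), u + v = g t :=
      fun t => Submodule.mem_sup.1 (hg t (Set.mem_univ t))
    choose u hu v hv huv using hg'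
    have hu' : ∀ t i, ∃ w, scalarMatrix (Q t) c w = u t i :=
      fun t i => (Submodule.mem_pi.1 (hu t)) i (Set.mem_univ i)
    choose w hw using hu'
    choose k hk using hv
    refine ⟨(piSwap (A := A) (T₁ := T₁) (T₂ := T₂) Q).symm (u + v), ?_, ?_⟩
    · refine Submodule.add_mem_sup ?_ ?_
      · rw [Submodule.mem_pi]
        intro i _
        refine ⟨fun a t => w t i a, ?_⟩
        funext b t
        rw [scalarMatrix_pi_apply]
        show scalarMatrix (Q t) c (w t i) b = u t i b
        rw [hw]
      · refine ⟨fun i j t => k t i j, ?_⟩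
        funext i j t
        show scalarMatrix (T₂ → (t : τ) → Q t) c' (fun i j t => k t i j) i j t = v t i j
        rw [← hk]
        simp [scalarMatrix_apply, Finset.sum_apply, Pi.smul_apply]
    · rw [LinearEquiv.coe_coe, LinearEquiv.apply_symm_apply]
      funext t
      exact huv t

/-- **`Y(Π_t Q_t) ≃ₗ[A] Π_t Y(Q_t)`.** -/
noncomputable def quotRelYPiEquiv :
    ((T₁ → T₂ → (t : τ) → Q t) ⧸ relY c c' ((t : τ) → Q t)) ≃ₗ[A]
      ((t : τ) → (T₁ → T₂ → Q t) ⧸ relY c c' (Q t)) :=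
  (Submodule.Quotient.equiv _ _ (piSwap (A := A) (T₁ := T₁) (T₂ := T₂) Q) (relY_pi_map_piSwap c c' Q)).trans
    (Submodule.quotientPi _)

end Prod

end Summit.Ventures.HSemireg.ObstructionLocus
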